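import Summits.BirchSwinnertonDyer.Rank1Residual.GaloisImage.HauptmodulThreeQuarticValuation
import HarnessLib

/-!
# The level-`9` Hauptmodul at `v₃(j) = 4` is VALUATION-FORCED: from `j(S − 27) = S(S − 24)³`,
# `v(S) = v(3)` and `θ³ = S` alone, `v(9θ²/(S − 6)² − 1)⁹ = v(3)`
# (cell `b2b-bsdres`, team n1011, seat p02 gen 5 — row T-b11-F4, file F4c-H2 'Hauptmodul route,
# curve-free core, part 2'; pure valuation algebra in `ℚ̄`, no elliptic curve in the statements)

HONEST FRAMING (cell `b2b-bsdres`, run/shared/lean/b2b/bsd-rank1-residual/, verbatim in every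
file): the goal of the cell is to DELETE the COMBINATION-SHAPED residual classes of the
Birch–Swinnerton-Dyer formula for ALL analytic-rank `≤ 1` elliptic curves over `ℚ` — "full BSD
formula for every rank `≤ 1` curve in class `C`" assembled STRICTLY from published theorems — so
that the rank-`≤ 1` remainder becomes exactly the CONSTRUCTION-SHAPED classes, which are TYPED
(missing-input `Prop`s), NOT attempted. This is not "finishing BSD". Team n1011 (N10 / N11):
research route; no claim beyond the stated classes; labels UNCHANGED; nothing is booked. Theorems
only (no definition, no named fact).

## What this file proves (M3-LOCAL-NOTE §8.3 "v₃(j) = 4 is valuation-forced", as a theorem)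

Let `v` be the place of `ℚ̄` over `3`, `t = v(3)`.  For an elliptic curve `E/ℚ` and a cyclic
subgroup `C ⊂ E[9]` of order `9`, the level-`9` Hauptmodul `η = η(E, C) ∈ ℚ(C)`
(`KleinFrickeLevelNine`: `η = (f³ − 6f² + 3f + 1)/(f(f − 1))`, `f` Kubert's coordinate) satisfies
`j·η(η² + 9η + 27) = (η + 3)³(η³ + 9η² + 27η + 3)³`, i.e. with `θ = η + 3`, `S = θ³`:
**`j(S − 27) = S(S − 24)³`**, and `S = A₁(P)³/A₃(P)` is the level-`3` Hauptmodul of `(E, 3C)`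
(`KleinFrickeLevelTwentySeven.level_nine_three_smul`), of valuation `v(S) = v(3)` when `3C` is NOT
the canonical subgroup.  Part 1 (`HauptmodulThreeQuarticValuation`) proved `v(ρ)³ = t` and
`v(9(2 + ρ)² − ρ⁶)³ = t⁷` for `ρ = S/3 − 2`.  This file concludes:

* `valuation_sub_one_pow_nine_of_cube` (§2) — the CUBE-ROOT LEMMA: `v(X³ − 1)³ = t` ⟹
  `v(X − 1)⁹ = t` (`X³ − 1 = (X − 1)(X − ω)(X − ω²)`, `v(1 − ω)² = t`).
* **`valuation_hauptmodul_nine_invariant_pow_nine`** (§3) — `j(S − 27) = S(S − 24)³`, `v₃(j) = 4`,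
  `v(S) = t`, `θ³ = S` ⟹ `S ≠ 6` and **`v(9θ²/(S − 6)² − 1)⁹ = t`**: the element
  `z = 9(η + 3)²/((η + 3)³ − 6)² − 1 ∈ ℚ(C)` has `3`-adic valuation exactly `1/9`
  (`X = θ²/ρ²`, `X³ − 1 = (9(2+ρ)² − ρ⁶)/ρ⁶`).

With `GaloisImage/NineTorsionScalarStabiliserSocket` (p283350) and the intermediate-field socket,
`9 ∣` denominator of a `Stab(C)`-invariant ⟹ the `3`-adic tower from surj(3): this is the kernel
route to the whole family `v₃(j) = 4` of the EXOTIC core (142 census cells; EVIDENCE kit j134538: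
`v(z) = 1/9` on all 9 non-canonical `C` of all 142 cells, sign-free).  Curve-side inputs still to
be filed: `η(E, C)` is `Stab(C)`-invariant (the orbit argument of `exists_hauptmodul_nine_of_torsion`)
and `v(S) = v(3)` for non-canonical `3C` (normal shape: `S = t_P³/u_P²`).  Nothing booked.

References: [Maier2006] R. S. Maier, J. Ramanujan Math. Soc. 24 (2009), Table 4 (N = 3, 9), §5.
-/

noncomputable section

set_option maxRecDepth 10000

open scoped Classical

namespace Summit.BirchSwinnertonDyer.Rank1Residual.GaloisImage

open Literature.NumberTheory.EllipticCurves Literature.NumberTheory.GaloisRepresentations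
  Rat.HeightOneSpectrum

/-! ### §2 The cube-root lemma -/

/-- **`v(X³ − 1) = v(3)^{1/3}` forces `v(X − 1) = v(3)^{1/9}`**: precisely `v(X³ − 1)³ = v(3)` ⟹
`v(X − 1)⁹ = v(3)`.  (`X³ − 1 = (X − 1)(X − ω)(X − ω²)` with `ω² + ω + 1 = 0`, `v(1 − ω)² = v(3)`;
if `v(X − 1) ≤ v(1 − ω)` the product would be at most `v(3)^{3/2}`.) [folklore] -/
theorem valuation_sub_one_pow_nine_of_cube {X : AlgebraicClosure ℚ}
    (h : (placeOver 3).valuation (X ^ 3 - 1) ^ 3 = (placeOver 3).valuation (3 : AlgebraicClosure ℚ)) :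
    (placeOver 3).valuation (X - 1) ^ 9 = (placeOver 3).valuation (3 : AlgebraicClosure ℚ) := by
  set v := (placeOver 3).valuation with hv
  set t := v (3 : AlgebraicClosure ℚ) with ht
  have ht1 : t < 1 := valuation_three_lt_one
  have ht0 : t ≠ 0 := valuation_three_ne_zero
  -- a primitive cube root of unity `ω = (−1 + δ)/2`, `δ² = −3`
  obtain ⟨δ, hδ⟩ := IsAlgClosed.exists_pow_nat_eq (-3 : AlgebraicClosure ℚ) (by norm_num : 0 < 2)
  set ω : AlgebraicClosure ℚ := (-1 + δ) / 2 with hω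
  have hω2 : ω ^ 2 + ω + 1 = 0 := by
    rw [hω]; field_simp; linear_combination hδ
  have hfac : X ^ 3 - 1 = (X - 1) * ((X - ω) * (X - ω ^ 2)) := by
    linear_combination (X - 1) * (X - ω + 1) * hω2
  have h3 : (1 - ω) * (1 - ω ^ 2) = 3 := by linear_combination (ω - 2) * hω2
  have hω3 : ω ^ 3 = 1 := by linear_combination (ω - 1) * hω2
  have hvω : v ω = 1 := by
    have h1 : v ω ^ 3 = 1 := by rw [← map_pow, hω3, map_one]
    rcases lt_trichotomy (v ω) 1 with hlt | heq | hgt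
    · exact absurd h1 (ne_of_lt (pow_lt_one₀ zero_le hlt (by norm_num)))
    · exact heq
    · exact absurd h1 (ne_of_gt (one_lt_pow₀ hgt (by norm_num)))
  have hb : v (1 - ω ^ 2) = v (1 - ω) := by
    rw [show (1 : AlgebraicClosure ℚ) - ω ^ 2 = (1 - ω) * (1 + ω) by ring, map_mul,
      show (1 : AlgebraicClosure ℚ) + ω = -ω ^ 2 by linear_combination hω2, Valuation.map_neg, map_pow,
      hvω, one_pow, mul_one]
  set b := v (1 - ω) with hbdef
  have hb2 : b ^ 2 = t := by
    have := congrArg v h3; rw [map_mul, hb] at this; rw [pow_two]; exact this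
  have hb0 : b ≠ 0 := by intro h0; rw [h0, zero_pow two_ne_zero] at hb2; exact ht0 hb2.symm
  set a := v (X - 1) with ha
  have hprod : v (X ^ 3 - 1) = a * (v (X - ω) * v (X - ω ^ 2)) := by rw [hfac, map_mul, map_mul]
  -- compare `a` with `b`
  rcases lt_trichotomy a b with hab | hab | hab
  · -- `a < b`: then `v(X − ω) = v(X − ω²) = b` and `v(X³ − 1)³ = a³ t³ < t`
    exfalso
    have e1 : v (X - ω) = b := by
      rw [show X - ω = (X - 1) + (1 - ω) by ring]; exact Valuation.map_add_eq_of_lt_right _ hab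
    have e2 : v (X - ω ^ 2) = b := by
      rw [show X - ω ^ 2 = (X - 1) + (1 - ω ^ 2) by ring, ← hb]
      exact Valuation.map_add_eq_of_lt_right _ (by rw [hb]; exact hab)
    rw [hprod, e1, e2] at h
    have hlt : (a * (b * b)) ^ 3 < t := by
      calc (a * (b * b)) ^ 3 = a ^ 3 * t ^ 3 := by rw [← pow_two, hb2, mul_pow]
        _ < 1 * t ^ 1 := by
          have ha1 : a ^ 3 < 1 := by
            have : a < 1 := hab.trans_le (by
              have : b ^ 2 < 1 := by rw [hb2]; exact ht1
              by_contra hb1; rw [not_le] at hb1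
              exact absurd this (not_lt.mpr (one_le_pow₀ hb1.le)))
            exact pow_lt_one₀ zero_le this (by norm_num)
          have ht3 : t ^ 3 ≤ t ^ 1 := pow_le_pow_of_le_one' ht1.le (by norm_num)
          calc a ^ 3 * t ^ 3 < 1 * t ^ 3 := mul_lt_mul_of_pos_right ha1 (pow_pos (zero_lt_iff.mpr ht0) 3)
            _ ≤ 1 * t ^ 1 := mul_le_mul' le_rfl ht3
        _ = t := by rw [one_mul, pow_one]
    exact absurd h hlt.ne
  · -- `a = b`: `v(X³ − 1) ≤ b³`, so `v(X³ − 1)³ ≤ b⁹ = t⁴ b < t`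
    exfalso
    have e1 : v (X - ω) ≤ b := by
      rw [show X - ω = (X - 1) + (1 - ω) by ring]
      exact (Valuation.map_add _ _ _).trans (max_le hab.le le_rfl)
    have e2 : v (X - ω ^ 2) ≤ b := by
      rw [show X - ω ^ 2 = (X - 1) + (1 - ω ^ 2) by ring]
      exact (Valuation.map_add _ _ _).trans (max_le hab.le hb.le)
    have hle : v (X ^ 3 - 1) ≤ b * t := by
      rw [hprod, hab]
      calc b * (v (X - ω) * v (X - ω ^ 2)) ≤ b * (b * b) := mul_le_mul' le_rfl (mul_le_mul' e1 e2)
        _ = b * t := by rw [← pow_two, hb2]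
    have : v (X ^ 3 - 1) ^ 3 ≤ (b * t) ^ 3 := pow_le_pow_left₀ zero_le hle 3
    rw [h] at this
    have hlt : (b * t) ^ 3 < t := by
      calc (b * t) ^ 3 = t ^ 4 * b := by
            rw [mul_pow, show b ^ 3 = b * b ^ 2 from pow_succ' b 2, hb2]
            simp only [pow_succ, pow_zero, one_mul, mul_comm, mul_left_comm]
        _ < t ^ 1 * 1 := by
          have hb1 : b < 1 := by
            by_contra hb1; rw [not_lt] at hb1
            have : 1 ≤ b ^ 2 := one_le_pow₀ hb1
            rw [hb2] at this; exact absurd ht1 (not_lt.mpr this)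
          calc t ^ 4 * b < t ^ 4 * 1 := mul_lt_mul_of_pos_left hb1 (pow_pos (zero_lt_iff.mpr ht0) 4)
            _ ≤ t ^ 1 * 1 := mul_le_mul' (pow_le_pow_of_le_one' ht1.le (by norm_num)) le_rfl
        _ = t := by rw [pow_one, mul_one]
    exact absurd this (not_le.mpr hlt)
  · -- `a > b`: all three factors have valuation `a`
    have e1 : v (X - ω) = a := by
      rw [show X - ω = (X - 1) + (1 - ω) by ring]; exact Valuation.map_add_eq_of_lt_left _ hab
    have e2 : v (X - ω ^ 2) = a := by
      rw [show X - ω ^ 2 = (X - 1) + (1 - ω ^ 2) by ring]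
      exact Valuation.map_add_eq_of_lt_left _ (by rw [hb]; exact hab)
    rw [hprod, e1, e2] at h
    rw [← h]
    simp only [pow_succ, pow_zero, one_mul, mul_assoc]

/-! ### §3 Assembly: the level-`9` invariant has valuation `1/9` -/

/-- **The level-`9` Hauptmodul at `v₃(j) = 4` is valuation-forced.**  Let `j ∈ ℚ` with `v₃(j) = 4`,
and `S, θ ∈ ℚ̄` with `j(S − 27) = S(S − 24)³` (the level-`3` relation, `S = t₃ + 27`),
`v(S) = v(3)` (the non-canonical branch) and `θ³ = S`.  Then `S ≠ 6`, and the invariant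
`z = 9θ²/(S − 6)² − 1` satisfies **`v(z)⁹ = v(3)`** — `3`-adic valuation exactly `1/9`.
For `θ = η(E, C) + 3` (`KleinFrickeLevelNine`, `level_nine_three_smul`) this `z` lies in `ℚ(C)` and
feeds the scalar-stabiliser socket (`9 ∣ [I : I ∩ Stab C]`). [cite: Maier2006, Table 4 (N = 3, 9)] -/
theorem valuation_hauptmodul_nine_invariant_pow_nine {j : ℚ} (hj : padicValRat 3 j = 4)
    {S θ : AlgebraicClosure ℚ}
    (hS : algebraMap ℚ (AlgebraicClosure ℚ) j * (S - 27) = S * (S - 24) ^ 3)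
    (hvS : (placeOver 3).valuation S = (placeOver 3).valuation (3 : AlgebraicClosure ℚ))
    (hθ : θ ^ 3 = S) :
    S - 6 ≠ 0 ∧
      (placeOver 3).valuation (9 * θ ^ 2 / (S - 6) ^ 2 - 1) ^ 9 =
        (placeOver 3).valuation (3 : AlgebraicClosure ℚ) := by
  haveI : Fact (Nat.Prime 3) := ⟨Nat.prime_three⟩
  set v := (placeOver 3).valuation with hv
  set t := v (3 : AlgebraicClosure ℚ) with ht
  have ht1 : t < 1 := valuation_three_lt_one
  have ht0 : t ≠ 0 := valuation_three_ne_zero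
  have h3 : (3 : AlgebraicClosure ℚ) ≠ 0 := by norm_num
  -- `J = j/81`, a `3`-adic unit
  have hj0 : j ≠ 0 := by
    intro h0; rw [h0, padicValRat.zero] at hj; norm_num at hj
  have h33 : padicValRat 3 (3 : ℚ) = 1 := by exact_mod_cast padicValRat.self (p := 3) (by norm_num)
  have h81 : padicValRat 3 (81 : ℚ) = 4 := by
    rw [show (81 : ℚ) = 3 ^ 4 by norm_num, padicValRat.pow, h33]; norm_num
  have hJ0 : j / 81 ≠ 0 := div_ne_zero hj0 (by norm_num)
  have hJv : padicValRat 3 (j / 81) = 0 := by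
    rw [padicValRat.div hj0 (by norm_num), hj, h81]; norm_num
  set J : AlgebraicClosure ℚ := algebraMap ℚ (AlgebraicClosure ℚ) (j / 81) with hJdef
  have hJ : v J = 1 := by
    have hm : padicValRat 3 (j / 81) = ((0 : ℕ) : ℤ) := by rw [hJv]; rfl
    have h := valuation_ratCast_eq_pow_of_padicValRat hJ0 hm
    rw [pow_zero] at h
    exact h
  have hJ2 : v (4 - J ^ 2) ≤ t := by
    have := valuation_four_sub_sq_le hJ0 hJv
    rwa [map_sub, map_pow, map_ofNat] at this
  have hjJ : algebraMap ℚ (AlgebraicClosure ℚ) j = 81 * J := by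
    rw [hJdef, map_div₀, map_ofNat]; field_simp
  -- the quartic for `ρ = S/3 − 2`
  set ρ := S / 3 - 2 with hρdef
  have hr : ρ ^ 4 - 16 * ρ ^ 3 + 72 * ρ ^ 2 - 3 * J * ρ + (21 * J - 432) = 0 := by
    have h := rho_quartic_of_hauptmodul_three (F := AlgebraicClosure ℚ) (j := 81 * J) (S := S)
      (by rw [← hjJ]; exact hS)
    have e : (81 : AlgebraicClosure ℚ) * J / 81 = J := by field_simp
    rw [e] at h
    exact h
  have hρ2 : v (ρ + 2) = 1 := by
    rw [hρdef, sub_add_cancel, map_div₀, hvS, ← ht, div_self ht0]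
  have hρ := valuation_rho_pow_three_eq hJ hρ2 hr
  have hN := valuation_nine_sq_sub_pow_six hJ hJ2 hr hρ
  -- `S − 6 = 3ρ ≠ 0`
  have hS6 : S - 6 = 3 * ρ := by rw [hρdef]; ring
  have hρ0 : ρ ≠ 0 := by
    intro h0; rw [h0, map_zero, zero_pow (by norm_num)] at hρ; exact ht0 hρ.symm
  have hS60 : S - 6 ≠ 0 := by rw [hS6]; exact mul_ne_zero h3 hρ0
  refine ⟨hS60, ?_⟩
  -- `X = 9θ²/(S−6)² = θ²/ρ²`, `X³ − 1 = (9(2+ρ)² − ρ⁶)/ρ⁶`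
  have hSρ : S = 3 * (2 + ρ) := by rw [hρdef]; ring
  have hX : 9 * θ ^ 2 / (S - 6) ^ 2 - 1 = θ ^ 2 / ρ ^ 2 - 1 := by
    rw [hS6]; field_simp; ring
  have hX3 : (θ ^ 2 / ρ ^ 2) ^ 3 - 1 = (9 * (2 + ρ) ^ 2 - ρ ^ 6) / ρ ^ 6 := by
    have : (θ ^ 2) ^ 3 = S ^ 2 := by rw [← hθ]; ring
    rw [div_pow, this, hSρ]
    field_simp
    ring
  have hvX3 : v ((θ ^ 2 / ρ ^ 2) ^ 3 - 1) ^ 3 = t := by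
    rw [hX3, map_div₀, div_pow, map_pow, hN, ← pow_mul, show 6 * 3 = 3 * 6 from rfl, pow_mul, hρ,
      show t ^ 7 = t ^ 6 * t by rw [← pow_succ], mul_div_cancel_left₀ _ (pow_ne_zero _ ht0)]
  rw [hX]
  exact valuation_sub_one_pow_nine_of_cube hvX3

end Summit.BirchSwinnertonDyer.Rank1Residual.GaloisImage

end
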